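import Literature.Topology.FourManifolds.SymplecticPairStabilizerBlocks
import Literature.LinearAlgebra.Matrix.IntegerElementaryMatrices
import Mathlib.Tactic.Group
import HarnessLib

/-!
# The integral stabiliser of a pair of coordinate Lagrangians, IV: generation by the compatible
# elementary moves

Topic `Literature/Topology/FourManifolds`; theorems only, sequel to
`SymplecticPairStabilizerAdmissible/Blocks.lean` (and, for its hypothesis `hU`,
`SymplecticPairStabilizerUnipotent.lean`).  Partition `t : ι → Bool` of the handles
(`T₀ = {t = false}`, `T₊ = {t = true}`), coordinate Lagrangians `Λ_A = span δ_{aᵢ}` and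
`Λ_t = span δ_{(i, t i)}` of `(ℤ^{ι × Bool}, ν)`.

**Theorem** (`mem_of_pairStabilizer`, `mem_of_pairStabilizer_signed`).  Let `R` be a subgroup
of `GL(ℤ^{ι × Bool})` containing the sign changes of the handles and the elementary moves
`moveZ i j n` for `t i = false ∨ t j = true`, `moveX j n` for `t j = false`, `moveW i j n` for
`t i = false ∨ t j = false`.  Then `R` contains every isometry `F` of `ν` with `F Λ_A ⊆ Λ_A` and
`F Λ_t ⊆ Λ_t`; if `R` also contains the anti-symplectic involution `δ_{aᵢ} ↦ -δ_{aᵢ}` then it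
contains every such ANTI-isometry as well.  (`Sp(2g, ℤ)` is generated by the elementary moves,
Zieschang–Vogt–Coldewey 3.6.10–3.6.12; this is the relative version for the parabolic-type
subgroup `Stab(Λ_A, Λ_t) = ((GL(T₀) × GL(T₊)) ⋉ unipotents)`, each factor `GLₙ(ℤ)` being
generated by its transvections `1 ± E_{ij}` and sign changes, Adkins–Weintraub Ch. 5 Thm. 2.10 —
`Literature.LinearAlgebra.Matrix.intElementary_induction_left`.)

Proof: `mem_of_adm` reduces the `T₀ × T₀` block of `F` to `1` by left multiplication with `moveZ`'s
and sign changes of `T₀` (the block is unimodular and multiplicative, `…Blocks.lean`), then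
`mem_of_fix_T0` reduces the `T₊ × T₊` block the same way.  The remaining UNIPOTENT STEP (an
admissible `F` with unipotent block upper triangular `a`-block lies in `R`) enters as the
hypothesis `hU`; it is the theorem `mem_of_blocks_eq_one` of `SymplecticPairStabilizerUnipotent.lean`
(kept as a hypothesis here only so that the two files are independent).
Consumed by the Goeritz group of the standard Heegaard splitting of `#ᵏ S¹×S²`
(`SurfaceGroupGoeritzMoves.lean` supplies the generators).

## References

* H. Zieschang, E. Vogt, H.-D. Coldewey, *Surfaces and Planar Discontinuous Groups*, LNM 835
  (1980), §3.6, 3.6.10–3.6.12. [ZieschangVogtColdewey1980]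
* W. A. Adkins, S. H. Weintraub, *Algebra. An Approach via Module Theory*, GTM 136 (1992), Ch. 5
  Thm. 2.10. [AdkinsWeintraub1992]
-/

noncomputable section

namespace Literature.Topology.FourManifolds

open Finset Matrix Literature.LinearAlgebra.Matrix

variable {ι : Type*} [Fintype ι] [DecidableEq ι]

/-! ## Columns of admissible automorphisms -/

omit [Fintype ι] in
/-- The columns `F δ_{a_q}`, `q ∈ T₀`, of an admissible `F` lie in `V = Λ_A ∩ Λ_t`. [folklore] -/
theorem cols_T0_of_adm (t : ι → Bool) (F : (ι × Bool → ℤ) ≃ₗ[ℤ] (ι × Bool → ℤ))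
    (hFa : ∀ v : ι × Bool → ℤ, (∀ i, v (i, true) = 0) → ∀ i, F v (i, true) = 0)
    (hFt : ∀ v : ι × Bool → ℤ, (∀ i, v (i, !t i) = 0) → ∀ i, F v (i, !t i) = 0)
    (q : ι) (hq : t q = false) :
    (∀ i, F (Pi.single (q, false) 1) (i, true) = 0) ∧
      ∀ i, t i = true → F (Pi.single (q, false) 1) (i, false) = 0 := by
  refine ⟨hFa _ (fun i => by simp), fun i hi => ?_⟩
  have := hFt (Pi.single (q, false) 1) (fun j => ?_) i
  · rwa [hi] at this
  · rw [Pi.single_apply, if_neg]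
    intro h
    rw [Prod.mk.injEq] at h
    obtain ⟨rfl, h2⟩ := h
    rw [hq] at h2
    exact absurd h2.symm (by decide)

omit [Fintype ι] in
/-- The columns `F δ_{b_i}`, `i ∈ T₊`, of an admissible `F` lie in `Λ_t`: no `b_p`-coordinate for
`p ∈ T₀`. [folklore] -/
theorem colT_of_adm (t : ι → Bool) (F : (ι × Bool → ℤ) ≃ₗ[ℤ] (ι × Bool → ℤ))
    (hFt : ∀ v : ι × Bool → ℤ, (∀ i, v (i, !t i) = 0) → ∀ i, F v (i, !t i) = 0)
    (i : ι) (hi : t i = true) (p : ι) (hp : t p = false) :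
    F (Pi.single (i, true) 1) (p, true) = 0 := by
  have := hFt (Pi.single (i, true) 1) (fun j => ?_) p
  · rwa [hp] at this
  · rw [Pi.single_apply, if_neg]
    intro h
    rw [Prod.mk.injEq] at h
    obtain ⟨rfl, h2⟩ := h
    rw [hi] at h2
    exact absurd h2.symm (by decide)

omit [Fintype ι] in
/-- The sign change of handle `k` fixes `δ_{a_q}` for `q ≠ k`. [folklore] -/
theorem signFlip_single_of_ne {k q : ι} (E : (ι × Bool → ℤ) ≃ₗ[ℤ] (ι × Bool → ℤ))
    (hE : ∀ v p, E v p = (if p.1 = k then -1 else 1) * v p) (hqk : q ≠ k) (s : Bool) :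
    E (Pi.single (q, s) 1) = Pi.single (q, s) 1 := by
  funext p
  rw [hE, Pi.single_apply]
  by_cases hp : p.1 = k
  · rw [if_pos hp, if_neg, mul_zero]
    rintro rfl
    exact hqk hp
  · rw [if_neg hp, one_mul]

/-! ## Reduction of the `T₊ × T₊` block -/

/-- **Second reduction**: an admissible `F` fixing the `δ_{a_q}`, `q ∈ T₀`, lies in `R` — reduce its
(unimodular, multiplicative) `T₊ × T₊` block to `1` by `moveZ i j` (`i, j ∈ T₊`) and sign changes
of `T₊`, along the elementary factorisation of the block, then apply `mem_of_blocks_eq_one`.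
[folklore] -/
theorem mem_of_fix_T0 (t : ι → Bool)
    (A : Subgroup ((ι × Bool → ℤ) ≃ₗ[ℤ] (ι × Bool → ℤ)))
    (hA : ∀ F, F ∈ A ↔ ((∀ u v, symplForm (F u) (F v) = symplForm u v) ∧
      (∀ v : ι × Bool → ℤ, (∀ i, v (i, true) = 0) → ∀ i, F v (i, true) = 0) ∧
      (∀ v : ι × Bool → ℤ, (∀ i, v (i, !t i) = 0) → ∀ i, F v (i, !t i) = 0)))
    (R : Subgroup ((ι × Bool → ℤ) ≃ₗ[ℤ] (ι × Bool → ℤ))) (hRA : R ≤ A)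
    (hZ : ∀ (i j : ι) (h : i ≠ j), (t i = false ∨ t j = true) → ∀ n : ℤ, moveZ i j h n ∈ R)
    (hE : ∀ j, ∃ E ∈ R, ∀ v p, E v p = (if p.1 = j then -1 else 1) * v p)
    (hU : ∀ F : (ι × Bool → ℤ) ≃ₗ[ℤ] (ι × Bool → ℤ), F ∈ A →
      (∀ q, t q = false → F (Pi.single (q, false) 1) = Pi.single (q, false) 1) →
      (∀ q, t q = true → ∀ p, t p = true →
        F (Pi.single (q, false) 1) (p, false) = if p = q then 1 else 0) → F ∈ R)
    (F : (ι × Bool → ℤ) ≃ₗ[ℤ] (ι × Bool → ℤ)) (hF : F ∈ A)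
    (h0 : ∀ q, t q = false → F (Pi.single (q, false) 1) = Pi.single (q, false) 1) : F ∈ R := by
  obtain ⟨hFs, hFa, hFt⟩ := (hA F).1 hF
  have hdet : IsUnit (Matrix.of fun p q : {i // t i = true} =>
      F (Pi.single (q.1, false) 1) (p.1, false)).det :=
    isUnit_det_blockTplus t F hFs (fun q i => hFa (Pi.single (q, false) 1) (fun j => by simp) i)
      (colT_of_adm t F hFt)
  suffices key : ∀ M : Matrix {i // t i = true} {i // t i = true} ℤ, IsUnit M.det →
      ∀ F : (ι × Bool → ℤ) ≃ₗ[ℤ] (ι × Bool → ℤ), F ∈ A →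
      (∀ q, t q = false → F (Pi.single (q, false) 1) = Pi.single (q, false) 1) →
      (Matrix.of fun p q : {i // t i = true} => F (Pi.single (q.1, false) 1) (p.1, false)) = M →
      F ∈ R from key _ hdet F hF h0 rfl
  intro M hM
  refine intElementary_induction_left (fun M => ∀ F : (ι × Bool → ℤ) ≃ₗ[ℤ] (ι × Bool → ℤ), F ∈ A →
      (∀ q, t q = false → F (Pi.single (q, false) 1) = Pi.single (q, false) 1) →
      (Matrix.of fun p q : {i // t i = true} => F (Pi.single (q.1, false) 1) (p.1, false)) = M →
      F ∈ R) ?_ ?_ ?_ M hM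
  · -- block `1`: the unipotent case
    intro F hF h0 hblock
    refine hU F hF h0 (fun q hq p hp => ?_)
    have := congrFun (congrFun hblock ⟨p, hp⟩) ⟨q, hq⟩
    rw [Matrix.of_apply, Matrix.one_apply] at this
    rw [this]
    by_cases h : p = q
    · subst h; rw [if_pos rfl, if_pos rfl]
    · rw [if_neg h, if_neg (fun e => h (congrArg Subtype.val e))]
  · -- a transvection of `T₊`: undo it by `moveZ i j (-s)`
    intro M i j hij s _ _ ih F hF h0 hblock
    obtain ⟨-, hFa, -⟩ := (hA F).1 hF
    have hij' : (i : ι) ≠ j := fun e => hij (Subtype.ext e)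
    set r : (ι × Bool → ℤ) ≃ₗ[ℤ] (ι × Bool → ℤ) := moveZ i.1 j.1 hij' (-s) with hr
    have hrR : r ∈ R := hZ _ _ hij' (Or.inr j.2) (-s)
    have hr0 : ∀ q, t q = false → r (Pi.single (q, false) 1) = Pi.single (q, false) 1 := by
      intro q hq
      refine moveZ_eq_self hij' _ ?_ ?_
      · rw [Pi.single_apply, if_neg]
        intro h
        rw [Prod.mk.injEq] at h
        have := j.2
        rw [h.1, hq] at this
        exact absurd this (by decide)
      · rw [Pi.single_apply, if_neg (by simp)]
    have h0' : ∀ q, t q = false → (r * F) (Pi.single (q, false) 1) = Pi.single (q, false) 1 :=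
      fun q hq => by rw [linearEquiv_mul_apply, h0 q hq, hr0 q hq]
    have hblock' : (Matrix.of fun p q : {i // t i = true} =>
        (r * F) (Pi.single (q.1, false) 1) (p.1, false)) = M := by
      rw [blockTplus_mul t r F (fun q i => hFa (Pi.single (q, false) 1) (fun j => by simp) i)
        (fun q hq p hp => ?_), hblock,
        ← Matrix.mul_assoc]
      · rw [show (Matrix.of fun p q : {i // t i = true} => r (Pi.single (q.1, false) 1) (p.1, false)) =
            Matrix.transvection i j (-s) from blockTplus_moveZ t i j hij (-s),
          transvection_mul_transvection_same _ _ hij, neg_add_cancel, transvection_zero, Matrix.one_mul]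
      · rw [hr0 q hq, Pi.single_apply, if_neg]
        intro h
        rw [Prod.mk.injEq] at h
        rw [h.1, hq] at hp
        exact absurd hp (by decide)
    have hmem := ih (r * F) (A.mul_mem (hRA hrR) hF) h0' hblock'
    rw [show F = r⁻¹ * (r * F) by group]
    exact R.mul_mem (R.inv_mem hrR) hmem
  · -- a sign change of `T₊`
    intro M k _ ih F hF h0 hblock
    obtain ⟨-, hFa, -⟩ := (hA F).1 hF
    obtain ⟨E, hER, hE'⟩ := hE k.1
    have hE0 : ∀ q, t q = false → E (Pi.single (q, false) 1) = Pi.single (q, false) 1 := by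
      intro q hq
      refine signFlip_single_of_ne E hE' (fun e => ?_) false
      have := k.2
      rw [← e, hq] at this
      exact absurd this (by decide)
    have h0' : ∀ q, t q = false → (E * F) (Pi.single (q, false) 1) = Pi.single (q, false) 1 :=
      fun q hq => by rw [linearEquiv_mul_apply, h0 q hq, hE0 q hq]
    have hblock' : (Matrix.of fun p q : {i // t i = true} =>
        (E * F) (Pi.single (q.1, false) 1) (p.1, false)) = M := by
      rw [blockTplus_mul t E F (fun q i => hFa (Pi.single (q, false) 1) (fun j => by simp) i)
        (fun q hq p hp => ?_), hblock,
        ← Matrix.mul_assoc, block_signFlip t k E hE', signChange_mul_signChange, Matrix.one_mul]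
      rw [hE0 q hq, Pi.single_apply, if_neg]
      intro h
      rw [Prod.mk.injEq] at h
      rw [h.1, hq] at hp
      exact absurd hp (by decide)
    have hmem := ih (E * F) (A.mul_mem (hRA hER) hF) h0' hblock'
    rw [show F = E⁻¹ * (E * F) by group]
    exact R.mul_mem (R.inv_mem hER) hmem

/-! ## Reduction of the `T₀ × T₀` block and the theorem for the admissible group -/

/-- **First reduction**: every admissible `F` lies in `R` — reduce its (unimodular,
multiplicative) `T₀ × T₀` block to `1` by `moveZ i j` (`i, j ∈ T₀`) and sign changes of `T₀`, then
apply `mem_of_fix_T0`. [folklore] -/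
theorem mem_of_adm (t : ι → Bool)
    (A : Subgroup ((ι × Bool → ℤ) ≃ₗ[ℤ] (ι × Bool → ℤ)))
    (hA : ∀ F, F ∈ A ↔ ((∀ u v, symplForm (F u) (F v) = symplForm u v) ∧
      (∀ v : ι × Bool → ℤ, (∀ i, v (i, true) = 0) → ∀ i, F v (i, true) = 0) ∧
      (∀ v : ι × Bool → ℤ, (∀ i, v (i, !t i) = 0) → ∀ i, F v (i, !t i) = 0)))
    (R : Subgroup ((ι × Bool → ℤ) ≃ₗ[ℤ] (ι × Bool → ℤ))) (hRA : R ≤ A)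
    (hZ : ∀ (i j : ι) (h : i ≠ j), (t i = false ∨ t j = true) → ∀ n : ℤ, moveZ i j h n ∈ R)
    (hE : ∀ j, ∃ E ∈ R, ∀ v p, E v p = (if p.1 = j then -1 else 1) * v p)
    (hU : ∀ F : (ι × Bool → ℤ) ≃ₗ[ℤ] (ι × Bool → ℤ), F ∈ A →
      (∀ q, t q = false → F (Pi.single (q, false) 1) = Pi.single (q, false) 1) →
      (∀ q, t q = true → ∀ p, t p = true →
        F (Pi.single (q, false) 1) (p, false) = if p = q then 1 else 0) → F ∈ R)
    (F : (ι × Bool → ℤ) ≃ₗ[ℤ] (ι × Bool → ℤ)) (hF : F ∈ A) : F ∈ R := by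
  obtain ⟨hFs, hFa, hFt⟩ := (hA F).1 hF
  have hdet : IsUnit (Matrix.of fun p q : {i // t i = false} =>
      F (Pi.single (q.1, false) 1) (p.1, false)).det :=
    isUnit_det_blockT0 t F hFs (cols_T0_of_adm t F hFa hFt)
  suffices key : ∀ M : Matrix {i // t i = false} {i // t i = false} ℤ, IsUnit M.det →
      ∀ F : (ι × Bool → ℤ) ≃ₗ[ℤ] (ι × Bool → ℤ), F ∈ A →
      (Matrix.of fun p q : {i // t i = false} => F (Pi.single (q.1, false) 1) (p.1, false)) = M →
      F ∈ R from key _ hdet F hF rfl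
  intro M hM
  refine intElementary_induction_left (fun M => ∀ F : (ι × Bool → ℤ) ≃ₗ[ℤ] (ι × Bool → ℤ), F ∈ A →
      (Matrix.of fun p q : {i // t i = false} => F (Pi.single (q.1, false) 1) (p.1, false)) = M →
      F ∈ R) ?_ ?_ ?_ M hM
  · -- block `1`: `F` fixes the `δ_{a_q}`, `q ∈ T₀`
    intro F hF hblock
    obtain ⟨-, hFa, hFt⟩ := (hA F).1 hF
    refine mem_of_fix_T0 t A hA R hRA hZ hE hU F hF fun q hq => ?_
    obtain ⟨hc1, hc2⟩ := cols_T0_of_adm t F hFa hFt q hq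
    funext ⟨p, s⟩
    cases s
    · rw [Pi.single_apply]
      simp only [Prod.mk.injEq, and_true]
      cases hp : t p
      · have := congrFun (congrFun hblock ⟨p, hp⟩) ⟨q, hq⟩
        rw [Matrix.of_apply, Matrix.one_apply] at this
        rw [this]
        by_cases h : p = q
        · subst h; rw [if_pos rfl, if_pos rfl]
        · rw [if_neg h, if_neg (fun e => h (congrArg Subtype.val e))]
      · rw [hc2 p hp, if_neg]
        rintro rfl
        rw [hp] at hq
        exact absurd hq (by decide)
    · rw [hc1 p, Pi.single_apply, if_neg (by simp)]
  · -- a transvection of `T₀`: undo it by `moveZ i j (-s)`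
    intro M i j hij s _ _ ih F hF hblock
    obtain ⟨-, hFa, hFt⟩ := (hA F).1 hF
    have hij' : (i : ι) ≠ j := fun e => hij (Subtype.ext e)
    set r : (ι × Bool → ℤ) ≃ₗ[ℤ] (ι × Bool → ℤ) := moveZ i.1 j.1 hij' (-s) with hr
    have hrR : r ∈ R := hZ _ _ hij' (Or.inl i.2) (-s)
    have hblock' : (Matrix.of fun p q : {i // t i = false} =>
        (r * F) (Pi.single (q.1, false) 1) (p.1, false)) = M := by
      rw [blockT0_mul t r F (cols_T0_of_adm t F hFa hFt), hblock, ← Matrix.mul_assoc,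
        show (Matrix.of fun p q : {i // t i = false} => r (Pi.single (q.1, false) 1) (p.1, false)) =
            Matrix.transvection i j (-s) from blockT0_moveZ t i j hij (-s),
        transvection_mul_transvection_same _ _ hij, neg_add_cancel, transvection_zero, Matrix.one_mul]
    have hmem := ih (r * F) (A.mul_mem (hRA hrR) hF) hblock'
    rw [show F = r⁻¹ * (r * F) by group]
    exact R.mul_mem (R.inv_mem hrR) hmem
  · -- a sign change of `T₀`
    intro M k _ ih F hF hblock
    obtain ⟨-, hFa, hFt⟩ := (hA F).1 hF
    obtain ⟨E, hER, hE'⟩ := hE k.1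
    have hblock' : (Matrix.of fun p q : {i // t i = false} =>
        (E * F) (Pi.single (q.1, false) 1) (p.1, false)) = M := by
      rw [blockT0_mul t E F (cols_T0_of_adm t F hFa hFt), hblock, ← Matrix.mul_assoc,
        block_signFlip t k E hE', signChange_mul_signChange, Matrix.one_mul]
    have hmem := ih (E * F) (A.mul_mem (hRA hER) hF) hblock'
    rw [show F = E⁻¹ * (E * F) by group]
    exact R.mul_mem (R.inv_mem hER) hmem

/-! ## The theorem -/

/-- **The stabiliser of a pair of coordinate Lagrangians in `Sp(2g, ℤ)` is generated by the
compatible elementary moves.**  If the subgroup `R` of `GL(ℤ^{ι × Bool})` contains the sign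
changes of the handles, `moveZ i j n` for `t i = false ∨ t j = true`, `moveX j n` for
`t j = false` and `moveW i j n` for `t i = false ∨ t j = false`, then `R` contains every isometry
`F` of `ν` with `F Λ_A ⊆ Λ_A` (`Λ_A = span δ_{aᵢ}`) and `F Λ_t ⊆ Λ_t` (`Λ_t = span δ_{(i, t i)}`).
[cite: ZieschangVogtColdewey1980, 3.6.10–3.6.12] -/
theorem mem_of_pairStabilizer (t : ι → Bool) (R : Subgroup ((ι × Bool → ℤ) ≃ₗ[ℤ] (ι × Bool → ℤ)))
    (hZ : ∀ (i j : ι) (h : i ≠ j), (t i = false ∨ t j = true) → ∀ n : ℤ, moveZ i j h n ∈ R)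
    (hX : ∀ j, t j = false → ∀ n : ℤ, moveX j n ∈ R)
    (hW : ∀ i j, i ≠ j → (t i = false ∨ t j = false) → ∀ n : ℤ, moveW i j n ∈ R)
    (hE : ∀ j, ∃ E ∈ R, ∀ v p, E v p = (if p.1 = j then -1 else 1) * v p)
    (hU : ∀ (A : Subgroup ((ι × Bool → ℤ) ≃ₗ[ℤ] (ι × Bool → ℤ))),
      (∀ F, F ∈ A ↔ ((∀ u v, symplForm (F u) (F v) = symplForm u v) ∧
        (∀ v : ι × Bool → ℤ, (∀ i, v (i, true) = 0) → ∀ i, F v (i, true) = 0) ∧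
        (∀ v : ι × Bool → ℤ, (∀ i, v (i, !t i) = 0) → ∀ i, F v (i, !t i) = 0))) →
      ∀ (R' : Subgroup ((ι × Bool → ℤ) ≃ₗ[ℤ] (ι × Bool → ℤ))), R' ≤ A →
      (∀ (i j : ι) (h : i ≠ j), (t i = false ∨ t j = true) → ∀ n : ℤ, moveZ i j h n ∈ R') →
      (∀ j, t j = false → ∀ n : ℤ, moveX j n ∈ R') →
      (∀ i j, i ≠ j → (t i = false ∨ t j = false) → ∀ n : ℤ, moveW i j n ∈ R') →
      ∀ F : (ι × Bool → ℤ) ≃ₗ[ℤ] (ι × Bool → ℤ), F ∈ A →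
      (∀ q, t q = false → F (Pi.single (q, false) 1) = Pi.single (q, false) 1) →
      (∀ q, t q = true → ∀ p, t p = true →
        F (Pi.single (q, false) 1) (p, false) = if p = q then 1 else 0) → F ∈ R')
    (F : (ι × Bool → ℤ) ≃ₗ[ℤ] (ι × Bool → ℤ))
    (hS : ∀ u v, symplForm (F u) (F v) = symplForm u v)
    (hLA : ∀ v : ι × Bool → ℤ, (∀ i, v (i, true) = 0) → ∀ i, F v (i, true) = 0)
    (hLt : ∀ v : ι × Bool → ℤ, (∀ i, v (i, !t i) = 0) → ∀ i, F v (i, !t i) = 0) : F ∈ R := by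
  obtain ⟨A, hA⟩ := exists_admSubgroup t
  have hE' : ∀ j, ∃ E ∈ R ⊓ A, ∀ v p, E v p = (if p.1 = j then -1 else 1) * v p := fun j => by
    obtain ⟨E, hER, hEf⟩ := hE j
    exact ⟨E, Subgroup.mem_inf.2 ⟨hER, (hA E).2 (signFlip_adm t j E hEf)⟩, hEf⟩
  have hZ' : ∀ (i j : ι) (h : i ≠ j), (t i = false ∨ t j = true) → ∀ n : ℤ, moveZ i j h n ∈ R ⊓ A :=
    fun i j h hij n => Subgroup.mem_inf.2 ⟨hZ i j h hij n, (hA _).2 (moveZ_adm t h hij n)⟩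
  have hX' : ∀ j, t j = false → ∀ n : ℤ, moveX j n ∈ R ⊓ A :=
    fun j hj n => Subgroup.mem_inf.2 ⟨hX j hj n, (hA _).2 (moveX_adm t hj n)⟩
  have hW' : ∀ i j, i ≠ j → (t i = false ∨ t j = false) → ∀ n : ℤ, moveW i j n ∈ R ⊓ A :=
    fun i j h hij n => Subgroup.mem_inf.2 ⟨hW i j h hij n, (hA _).2 (moveW_adm t h hij n)⟩
  have key := mem_of_adm t A hA (R ⊓ A) inf_le_right hZ' hE'
    (hU A hA (R ⊓ A) inf_le_right hZ' hX' hW') F ((hA F).2 ⟨hS, hLA, hLt⟩)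
  exact (Subgroup.mem_inf.1 key).1

omit [DecidableEq ι] in
/-- The anti-symplectic involution `δ_{aᵢ} ↦ -δ_{aᵢ}`, `δ_{bᵢ} ↦ δ_{bᵢ}` reverses the form.
[folklore] -/
theorem symplForm_orientationFlip_apply (Θ : (ι × Bool → ℤ) ≃ₗ[ℤ] (ι × Bool → ℤ))
    (hΘ : ∀ v p, Θ v p = (if p.2 then 1 else -1) * v p) (u v : ι × Bool → ℤ) :
    symplForm (Θ u) (Θ v) = -symplForm u v := by
  rw [symplForm_apply, symplForm_apply, ← Finset.sum_neg_distrib]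
  refine Finset.sum_congr rfl fun i _ => ?_
  simp only [hΘ, if_true, Bool.false_eq_true, if_false]
  ring

/-- **The stabiliser of a pair of coordinate Lagrangians in `Sp^{±}(2g, ℤ)`.**  If moreover `R`
contains the anti-symplectic involution `Θ : δ_{aᵢ} ↦ -δ_{aᵢ}, δ_{bᵢ} ↦ δ_{bᵢ}`, then `R`
contains every `ε`-isometry (`ε = ±1`) of `ν` stabilising `Λ_A` and `Λ_t`.
[cite: ZieschangVogtColdewey1980, 3.6.7 and 3.6.10–3.6.12] -/
theorem mem_of_pairStabilizer_signed (t : ι → Bool)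
    (R : Subgroup ((ι × Bool → ℤ) ≃ₗ[ℤ] (ι × Bool → ℤ)))
    (hZ : ∀ (i j : ι) (h : i ≠ j), (t i = false ∨ t j = true) → ∀ n : ℤ, moveZ i j h n ∈ R)
    (hX : ∀ j, t j = false → ∀ n : ℤ, moveX j n ∈ R)
    (hW : ∀ i j, i ≠ j → (t i = false ∨ t j = false) → ∀ n : ℤ, moveW i j n ∈ R)
    (hE : ∀ j, ∃ E ∈ R, ∀ v p, E v p = (if p.1 = j then -1 else 1) * v p)
    (hΘ : ∃ Θ ∈ R, ∀ v p, Θ v p = (if p.2 then 1 else -1) * v p)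
    (hU : ∀ (A : Subgroup ((ι × Bool → ℤ) ≃ₗ[ℤ] (ι × Bool → ℤ))),
      (∀ F, F ∈ A ↔ ((∀ u v, symplForm (F u) (F v) = symplForm u v) ∧
        (∀ v : ι × Bool → ℤ, (∀ i, v (i, true) = 0) → ∀ i, F v (i, true) = 0) ∧
        (∀ v : ι × Bool → ℤ, (∀ i, v (i, !t i) = 0) → ∀ i, F v (i, !t i) = 0))) →
      ∀ (R' : Subgroup ((ι × Bool → ℤ) ≃ₗ[ℤ] (ι × Bool → ℤ))), R' ≤ A →
      (∀ (i j : ι) (h : i ≠ j), (t i = false ∨ t j = true) → ∀ n : ℤ, moveZ i j h n ∈ R') →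
      (∀ j, t j = false → ∀ n : ℤ, moveX j n ∈ R') →
      (∀ i j, i ≠ j → (t i = false ∨ t j = false) → ∀ n : ℤ, moveW i j n ∈ R') →
      ∀ F : (ι × Bool → ℤ) ≃ₗ[ℤ] (ι × Bool → ℤ), F ∈ A →
      (∀ q, t q = false → F (Pi.single (q, false) 1) = Pi.single (q, false) 1) →
      (∀ q, t q = true → ∀ p, t p = true →
        F (Pi.single (q, false) 1) (p, false) = if p = q then 1 else 0) → F ∈ R')
    (F : (ι × Bool → ℤ) ≃ₗ[ℤ] (ι × Bool → ℤ)) (ε : ℤ) (hε : ε = 1 ∨ ε = -1)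
    (hS : ∀ u v, symplForm (F u) (F v) = ε * symplForm u v)
    (hLA : ∀ v : ι × Bool → ℤ, (∀ i, v (i, true) = 0) → ∀ i, F v (i, true) = 0)
    (hLt : ∀ v : ι × Bool → ℤ, (∀ i, v (i, !t i) = 0) → ∀ i, F v (i, !t i) = 0) : F ∈ R := by
  rcases hε with rfl | rfl
  · exact mem_of_pairStabilizer t R hZ hX hW hE hU F (fun u v => by rw [hS, one_mul]) hLA hLt
  · obtain ⟨Θ, hΘR, hΘf⟩ := hΘ
    have hmem : Θ * F ∈ R := by
      refine mem_of_pairStabilizer t R hZ hX hW hE hU (Θ * F) (fun u v => ?_) (fun v hv i => ?_)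
        (fun v hv i => ?_)
      · rw [linearEquiv_mul_apply, linearEquiv_mul_apply, symplForm_orientationFlip_apply Θ hΘf, hS]
        ring
      · rw [linearEquiv_mul_apply, hΘf, hLA v hv i, mul_zero]
      · rw [linearEquiv_mul_apply, hΘf, hLt v hv i, mul_zero]
    rw [show F = Θ⁻¹ * (Θ * F) by group]
    exact R.mul_mem (R.inv_mem hΘR) hmem

end Literature.Topology.FourManifolds

end
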